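import Mathlib.Tactic
import HarnessLib

/-!
# T3.6 arm M″ of the stub-critic's STUB-PLAN v3.0 for `stub_heegnerIndexLowerAtTwo` (crux `PrintCf2.SplitBadTwoLowerHalfOfFacts`,
# stmt-BirchSwinnertonDyer-27851): arm M′ RE-BASED on the EXACT restricted control identity S3c
# (`PrintCf2.SelmerLocImage.restrictedControl_two_holds`, p684223, 2026-08-29T01:00Z) — the anchor's descent digits are RETIRED

Scratch certificate of seat `scrit-stub_heegnerIndexLowerAtTwo` g14 (planner, stub-critic; NOT a proposal — published as a crux
workfile and attached as evidence). THEOREMS ONLY over `ℤ` (valuation shadow), no `sorry`, no definitions, no named facts, nothing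
asserted about BSD. It supersedes g13's `StubPlanT3ArmMPrimeCalibration.lean` (arm M′, v2.8) in ONE respect: the member's one-sided
control-with-tables (`n ≤ b + c`, `b ≤ B + t`, `c ≤ k`) and the anchor's four-term identity (`n₀ + φ₀ + kk₀ = b₀ + c₀`) are BOTH
replaced by the tree THEOREM S3c, which on every frame of the class (members AND the BSD₂-certified anchors `cm7^{(d₀)}`,
`d₀ ∈ {−1, 2, −2}`, all of analytic rank one, `d % 4 ≠ 1`) reads, in valuation shadow,

  `n_W = B_W + g_W + eC(key W)`,  `B_W := v₂ #Ш(W/ℚ)[2^∞]`,  `g_W := v₂ Tam(W) − 2·v₂ #W(ℚ)_tors + 2ℓ_W` (explicit per member),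

with `∃ eC : ℤ → ℤ → ℤ` a function of the dyadic KEY only (`eC (d % 2) ((d / (2 − d % 2)) % 8)`); and the S2′ item of record
(route-C 23721 `RubinValueFormulaAtTwo`, token-for-token) reads `m_W = 2·(A_W + g_W) + eA(key W)`, `A_W := v₂ Ш_an(W)`, with the SAME
`g_W` — so `g_W` (Tamagawa, torsion, the generator's log-depth `ℓ_W`) CANCELS on each curve separately. Consequences certified below:

* `armMsecond_member_exact` — on a key that owns a certified anchor (same `eC` symbol at member and anchor) the member bound is
  `A ≤ B` EXACTLY: no `Δ₀`, no `φ₀ / kk₀ / b₀ / c₀`, no tables `t, k`, no parity. The two class inputs are the UNCHANGED floors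
  (F-A) `eA(W₀) ≤ eA(W)` (local type, k1-g9 / T3.7-LT) and (C-M) `eM(W) ≤ eM(W₀)` (⟺ `σ₀ ≤ σ`, R91).
* `armMsecond_of_T1minus` — the same, end to end in road T1⁻'s cofactor form (`ε ≥ 0` at the member, `ε₀ = 0` at the anchor by
  Müller 2020 Thm 3.21, generation defect monotone `σ₀ ≤ σ`), exactly as g13's `armMprime_of_T1minus`.
* `armMsecond_crossKey` — across a δ-pair (anchor in key k₀, member in key k) the ONLY new defect is the key-table difference
  `eC(k) − eC(k₀)`: `A ≤ B + (eC − eC₀)`; `crossKey_sharp` shows it is attained. Hence R96: the EXPLICIT `eC` table (the witness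
  inside the constructive proofs p680684 → p678471 → p678864), or a certified anchor per key (R92).
* `existsOnly_eC_does_not_calibrate` — B8 of the battery in this currency: if member and anchor are only given `∃ eC` SEPARATELY
  (two unrelated symbols), nothing bounds `A`.
* `oldDigits_of_S3c` — the v2.8 anchor package is implied: S3c at the anchor with `A₀ = B₀` IS the calibration `kit_reads…` wanted,
  so R89 (exhibits `b₀, c₀`), R90 (CYC — whose lemma «dim X/𝔪X ≤ 1 ⟹ no finite submodule» is moreover FALSE, card k3-g12 §A) and
  R93 (b) leave the plan.

References: STUB-PLAN v3.0 §1 rows 33–34, §4 (T2⁻)″/(T3.6-M″); g13 certificate `StubPlanT3ArmMPrimeCalibration.lean` (crux commit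
f816da8ed55e); tree `Theorems/PrintCf2SplitBadTwoRestrictedControlHolds.lean` (`restrictedControl_two_holds`, p684223);
K. Müller, arXiv:2002.05647 Thm 3.21; A. Agboola, Compositio 143 (2007) §3 Prop. 3.2, §8 Prop. 8.1 [Agboola2007].
-/

-- the summit namespace `Summit.BirchSwinnertonDyer.BirchSwinnertonDyer` repeats the problem name by design (D-0017)
set_option linter.dupNamespace false
set_option autoImplicit false

namespace Summit.BirchSwinnertonDyer.BirchSwinnertonDyer.Cruxes.SplitBadTwoLowerHalfOfFacts.StubPlanT3ArmMSecond

/-- ARM M″, SAME-KEY ANCHOR: member S2′ shape + containment + S3c EXACT; anchor S2′ shape + ES-direction + S3c EXACT (same key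
⟹ same `eC`) + BSD₂; class floors on the g-adjusted analytic offset and on the algebraic offset. Conclusion: `A ≤ B` exactly. -/
theorem armMsecond_member_exact {A B m n g eA eM eC A₀ B₀ m₀ n₀ g₀ eA₀ eM₀ : ℤ}
    (hS2 : m = 2 * (A + g) + eA) (hMC : m ≤ 2 * n + eM) (hS3c : n = B + g + eC)
    (hS2₀ : m₀ = 2 * (A₀ + g₀) + eA₀) (hES₀ : 2 * n₀ + eM₀ ≤ m₀) (hS3c₀ : n₀ = B₀ + g₀ + eC) (hBSD₀ : A₀ = B₀)
    (hflA : eA₀ ≤ eA) (hceM : eM ≤ eM₀) :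
    A ≤ B := by
  omega

/-- Road T1⁻ at a MEMBER (cofactor form, g13): `2n = m − e + ρ + 2ε + 2σ`, `ε ≥ 0` ⟹ containment with constant `e − ρ − 2σ`. -/
theorem mc_at_member_of_cofactor {m n e ρ ε σ : ℤ} (hT1 : 2 * n = m - e + ρ + 2 * ε + 2 * σ) (hε : 0 ≤ ε) :
    m ≤ 2 * n + (e - ρ - 2 * σ) := by
  omega

/-- Road T1⁻ at the ANCHOR: ES-direction with constant `e − ρ − 2σ₀` iff `ε₀ = 0` (Müller 2020 Thm 3.21: `μ = 0`). -/
theorem es_at_anchor_of_cofactor {m₀ n₀ e ρ ε₀ σ₀ : ℤ} (hT1 : 2 * n₀ = m₀ - e + ρ + 2 * ε₀ + 2 * σ₀) (hε₀ : ε₀ = 0) :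
    2 * n₀ + (e - ρ - 2 * σ₀) ≤ m₀ := by
  omega

/-- END TO END on road T1⁻, same-key anchor: `A ≤ B` from S2′ shapes, the two cofactor identities, S3c twice, BSD₂ at the anchor,
the g-adjusted analytic floor and generation-defect monotonicity `σ₀ ≤ σ`. No descent digit, no table, no parity. -/
theorem armMsecond_of_T1minus {A B m n g eA eC A₀ B₀ m₀ n₀ g₀ eA₀ e ρ ε σ ε₀ σ₀ : ℤ}
    (hS2 : m = 2 * (A + g) + eA) (hT1 : 2 * n = m - e + ρ + 2 * ε + 2 * σ) (hε : 0 ≤ ε) (hS3c : n = B + g + eC)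
    (hS2₀ : m₀ = 2 * (A₀ + g₀) + eA₀) (hT1₀ : 2 * n₀ = m₀ - e + ρ + 2 * ε₀ + 2 * σ₀) (hε₀ : ε₀ = 0)
    (hS3c₀ : n₀ = B₀ + g₀ + eC) (hBSD₀ : A₀ = B₀)
    (hflA : eA₀ ≤ eA) (hσ : σ₀ ≤ σ) :
    A ≤ B :=
  armMsecond_member_exact hS2 (mc_at_member_of_cofactor hT1 hε) hS3c hS2₀ (es_at_anchor_of_cofactor hT1₀ hε₀) hS3c₀ hBSD₀
    hflA (by omega)

/-- ARM M″ ACROSS A δ-PAIR: anchor in key `k₀` (`eC₀`), member in key `k` (`eC`). The only new defect is `eC − eC₀`. -/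
theorem armMsecond_crossKey {A B m n g eA eM eC A₀ B₀ m₀ n₀ g₀ eA₀ eM₀ eC₀ : ℤ}
    (hS2 : m = 2 * (A + g) + eA) (hMC : m ≤ 2 * n + eM) (hS3c : n = B + g + eC)
    (hS2₀ : m₀ = 2 * (A₀ + g₀) + eA₀) (hES₀ : 2 * n₀ + eM₀ ≤ m₀) (hS3c₀ : n₀ = B₀ + g₀ + eC₀) (hBSD₀ : A₀ = B₀)
    (hflA : eA₀ ≤ eA) (hceM : eM ≤ eM₀) :
    A ≤ B + (eC - eC₀) := by
  omega

/-- … and that cross-key bound is ATTAINED (all slacks zero, `eC − eC₀ = 1` gives `A = B + 1`): without the explicit `eC` table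
(R96) or a certified anchor in the member's own key (R92) the partner keys (1,3), (0,5), (0,3) are NOT closed by arm M″. -/
theorem crossKey_sharp : ∃ A B m n g eA eM eC A₀ B₀ m₀ n₀ g₀ eA₀ eM₀ eC₀ : ℤ,
    m = 2 * (A + g) + eA ∧ m ≤ 2 * n + eM ∧ n = B + g + eC ∧
    m₀ = 2 * (A₀ + g₀) + eA₀ ∧ 2 * n₀ + eM₀ ≤ m₀ ∧ n₀ = B₀ + g₀ + eC₀ ∧ A₀ = B₀ ∧
    eA₀ ≤ eA ∧ eM ≤ eM₀ ∧ eC - eC₀ = 1 ∧ A = B + 1 := by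
  refine ⟨1, 0, 2, 1, 0, 0, 0, 1, 0, 0, 0, 0, 0, 0, 0, 0, ?_⟩
  norm_num

/-- B8 in S3c currency: `∃ eC` read SEPARATELY at member and anchor (two unrelated symbols `eC`, `eC'`) calibrates nothing —
every hypothesis holds and `A = B + 100`. The theorem's `∃ eC` must be opened ONCE and the same function evaluated at both curves. -/
theorem existsOnly_eC_does_not_calibrate : ∃ A B m n g eA eM eC A₀ B₀ m₀ n₀ g₀ eA₀ eM₀ eC' : ℤ,
    m = 2 * (A + g) + eA ∧ m ≤ 2 * n + eM ∧ n = B + g + eC ∧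
    m₀ = 2 * (A₀ + g₀) + eA₀ ∧ 2 * n₀ + eM₀ ≤ m₀ ∧ n₀ = B₀ + g₀ + eC' ∧ A₀ = B₀ ∧
    eA₀ ≤ eA ∧ eM ≤ eM₀ ∧ A = B + 100 := by
  refine ⟨100, 0, 200, 100, 0, 0, 0, 100, 0, 0, 0, 0, 0, 0, 0, 0, ?_⟩
  norm_num

/-- THE OLD ANCHOR PACKAGE IS IMPLIED. g13's member hypotheses (`n ≤ b + c`, `b ≤ B + t`, `c ≤ k`) and anchor identity
(`n₀ + φ₀ + kk₀ = b₀ + c₀`) produced `A ≤ B + Δ₀`, `Δ₀ = φ₀ + kk₀ + (B₀ + t − b₀) + (k − c₀)`; with S3c EXACT at both curves the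
tables become `t + k = g + eC` digit for digit and `Δ₀ = 0` — here as the statement that S3c at member and anchor FORCES the old
shape with zero defect (take `b := B + g + eC`, `c := 0`, `t := g + eC`, `k := 0`, `b₀ := n₀`, `c₀ := 0`, `φ₀ := 0`, `kk₀ := 0`;
the `(g₀ − g)` shift is the member/anchor difference of the explicit bracket, which v2.8 hid inside `t`). -/
theorem oldDigits_of_S3c {B n g eC B₀ n₀ g₀ : ℤ} (hS3c : n = B + g + eC) (hS3c₀ : n₀ = B₀ + g₀ + eC) :
    ∃ b c t k b₀ c₀ φ₀ kk₀ : ℤ,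
      n ≤ b + c ∧ b ≤ B + t ∧ c ≤ k ∧ n₀ + φ₀ + kk₀ = b₀ + c₀ ∧
      φ₀ + kk₀ + (B₀ + (t + (g₀ - g)) - b₀) + (k - c₀) = 0 := by
  refine ⟨B + g + eC, 0, g + eC, 0, n₀, 0, 0, 0, ?_, ?_, le_refl 0, ?_, ?_⟩ <;> omega

/-- WHAT A KIT WOULD NOW READ at the anchor (R66 (iii) stays a CROSS-CHECK): the Katz-side number `m₀` equals
`2(B₀ + g₀ + eC) + eM₀` under the anchor equalities — it reads the SUM `2eC + eM₀` of the key table and the T1⁻ constant; S3c's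
explicit `eC` (R96) then isolates `eM₀`, and conversely. -/
theorem kit_reads_keyTable_add_constant {B₀ g₀ eC m₀ n₀ eM₀ : ℤ} (hMC₀ : m₀ = 2 * n₀ + eM₀) (hS3c₀ : n₀ = B₀ + g₀ + eC) :
    m₀ = 2 * (B₀ + g₀) + (2 * eC + eM₀) := by
  omega

/-- CONTRAST kept from g13: CONTAINMENT (instead of the ES-direction) at the anchor calibrates nothing, S3c or not. -/
theorem containment_only_does_not_calibrate_S3c : ∃ A B m n g eA eM eC A₀ B₀ m₀ n₀ g₀ eA₀ eM₀ : ℤ,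
    m = 2 * (A + g) + eA ∧ m ≤ 2 * n + eM ∧ n = B + g + eC ∧
    m₀ = 2 * (A₀ + g₀) + eA₀ ∧ m₀ ≤ 2 * n₀ + eM₀ ∧ n₀ = B₀ + g₀ + eC ∧ A₀ = B₀ ∧
    eA₀ ≤ eA ∧ eM ≤ eM₀ ∧ A = B + 100 := by
  refine ⟨100, 0, 200, 0, 0, 0, 200, 0, 0, 0, 0, 0, 0, 0, 200, ?_⟩
  norm_num

end Summit.BirchSwinnertonDyer.BirchSwinnertonDyer.Cruxes.SplitBadTwoLowerHalfOfFacts.StubPlanT3ArmMSecond
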